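import Literature.MathematicalPhysics.QuantumFieldTheory.Balaban1983to89.B14Ineq319From190
import Literature.MathematicalPhysics.QuantumFieldTheory.Balaban1983to89.B14Eq322Analytic

/-!
# `Balaban1983to89.B14Eq322From190` — T. Bałaban, *Convergent renormalization expansions for lattice gauge theories*,
# Commun. Math. Phys. **119** (1988) 243–285 [Balaban1988Convergent] = [III], p. 269 after (3.22): *"we obtain that 𝐇^{(k)} is
# an analytic function of the background field U_{k+1} restricted to Λ_{k+1}^c∩Λ_k, bounded on the set S_{k+1} by
# O(1)ε_k exp(−R_k), hence by any positive power of g_k"* — the BOUND, END-TO-END on p29's lattice model from the exponential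
# decay property (190) of [15] = [Balaban1985Variational]: print's *"We use again the formula (3.17), but with U_{k+1,□′}
# replaced by the above function. It yields the representation (3.18) … with similar bounds"* = p29's
# `B14Ineq319Proof.ineq319_first_local` with its hypothesis `h318` DERIVED (r11's `B14Ineq319From190`), composed with gen-4's
# `B14.Eq322Analytic.norm_bH_le_O1` / `norm_bH_le_pow` whose (3.18)-type hypothesis is thereby DISCHARGED

statement-level skeleton of published theorems with citation tags; proofs where landed; nothing here is a claim
about the Yang–Mills mass gap

CITATION HEADER (lean-in-tree rule 2026-08-18).  T. Bałaban, *Convergent renormalization expansions for lattice gauge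
theories*, Commun. Math. Phys. **119**, 243–285 (1988), doi:10.1007/BF01217741, bib `Balaban1988Convergent` (cell paper
B14 = "[III]").  PDF held: `paper:balaban1988-cmp119-convergent-renormalization` (journal page = PDF page + 242), p. 269
[PDF 27] (OCR `p0027.txt`, this seat 2026-08-21) and p. 268 [PDF 26] (x2 render).  "[15]" = [Balaban1985Variational] (190)
p. 308 (`B11SectG.Ineq190`); "[12]" = [Balaban1985Averaging] ((164)/(166), inside p29's file, and (21) the `log` series
`MatrixLog.mlog` of `B14.Eq316.bH`).

WHAT IS REPRODUCED.  SKELETON row **B14.Eq3.21–3.22** (member: the two clauses after (3.22); rows of record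
`lit-balaban-r11/ROWS-B14.md`: «proved p248190 (gen 4 …: «𝐇^{(k)} is an analytic function …, bounded on the set S_{k+1} by
O(1)ε_k exp(−R_k), hence by any positive power of g_k» PROVED for `bH` as the printed mechanism, the [15]-analyticity and the
(3.18)-type smallness explicit hypotheses)»), mega-formalization `lit-balaban`, HOME `run/shared/lean/pub/lit-balaban/`, unit
`lit-balaban-r11` gen 7 (reader/typer and fold owner of block B14).  KNITTING — used BY NAME, nothing restated: r11's
`B14Ineq319From190.boundH318_of_ineq190_second` (the (3.18)-type bound on `𝐇_{k+1,·}` from (190) + (2.8)/(2.9)), p29's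
`B14Ineq319Proof.ineq319_first_local` (the [12]-mechanism at the next-finer exponent scale), gen-4's
`B14.Eq322Analytic.norm_bH_le_O1` / `norm_bH_le_pow` (`‖𝐇^{(k)}(b)‖ ≤ 2‖V W⁻¹ − 1‖`, `e^{−R_k} ≤ g_k^{2N}`), r11's
`B14Ineq319From190.located319_of_gamma` and r12's `B15GammaSmallness.exp_neg_R_le_gamma_sq` (γ-forms).

THE PRINTED TEXT (p. 269, verbatim up to OCR): *"We take the determining set 𝐁(Λ^c_{k+1}∩Λ_k)∪𝐁_{k+1} defined in (2.14), which
in this case is simply equal to the union 𝐁_{k+1}(Λ_{k+1})∖Ω_{k+1} ∪ 𝐁_k(Λ_k)∖Ω^c_{k+1}, and the corresponding function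
[U_{k+1,Λ^c_{k+1}∩Λ_k}].  We want to replace V^{(k)} by the k-th average of the above function. We use again the formula (3.17),
but with U_{k+1,□′} replaced by the above function. It yields the representation (3.18) with the corresponding changes, e.g.,
V^{(k)}_{□′} is replaced by V^{(k)}_{Λ^c_{k+1}∩Λ_k}, and with similar bounds. Denoting [𝐇^{(k)} = (1/i) log V^{(k)}(V^{(k)}_{Λ^c_{k+1}∩Λ_k})⁻¹
… (3.22)] we obtain that 𝐇^{(k)} is an analytic function of the background field U_{k+1} restricted to Λ_{k+1}^c∩Λ_k, bounded
on the set S_{k+1} by O(1)ε_k exp(−R_k), hence by any positive power of g_k."*  (p. 268, (3.18)–(3.19): *"the argument of the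
function 𝐇_{k+1,□} is bounded by 44d²B₃ε_{k+1}, and has a support in a boundary layer … Thus, the function 𝐇_{k+1,□′} is bounded by
B₃exp(−δLM₂R_{k+1})44d²B₃ε_{k+1} ≦ 44d²B₃²(1+β₀)exp(−R_k)ε_k … |V^{(k)}(b)(V^{(k)}_{□′}(b))⁻¹ − 1| < O(1)44d²B₃²(1+β₀)ε_k exp(−R_k)"*.)

WHAT THIS FILE PROVES (kernel-checked, zero `sorry`; no `def`, no new `Prop`, no new named fact; axioms standard).  In p29's
lattice model (`V^{(k)}(b) = M^k((e^{iL^{−(k+1)}𝐇}U₀)^{u⁻¹})(b)`, `V^{(k)}_{Λ^c_{k+1}∩Λ_k}(b) = M^k(U₀)(b)`, `U₀ = U_{k+1,Λ^c_{k+1}∩Λ_k}`,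
`𝐇 = 𝐇_{k+1,Λ^c_{k+1}∩Λ_k}`, `u = glev` — (3.17)/(3.18) *"with U_{k+1,□′} replaced"*), for gen-4's `bH V W = (1/i)log(V W⁻¹)` ((3.22)):
* `norm_bH322_le_lattice_of_ineq190` — **the bound** `‖𝐇^{(k)}(b)‖ ≤ 2·K·ε_k·e^{−R_k}`, `K = (68(d+1)+160d)·44d²B₃²(1+β₀)` (print's
  O(1) made explicit), from: (190) for the block size `bout` of `𝐇_{k+1,·}` at the base point `y` and every `t`, (2.61), the
  argument field of B-size `≤ 44d²B₃ε_{k+1}` vanishing on the blocks closer than `D` to `y`, `δLM₂R_{k+1} ≤ τD`, `Cκ_Bc ≤ B₃`,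
  mean-value domination, (2.8) `ε_{k+1} ≤ (1+β₀)ε_k`, `R_k ≤ δLM₂R_{k+1}` ((2.9), `B14Ineq319From190.R_le_of_flowIneq29`), ONE
  dictionary hypothesis `hdom` (the block size dominates `‖𝐇(y′,μ)‖` on `B^k(b₋) ∪ B^k(b₊)`), p29's located side conditions
  verbatim, and the smallness `K·ε_k·e^{−R_k} ≤ ½` (the domain of the `log` series; print: *"is small"*).
* `norm_bH322_le_pow_lattice_of_ineq190` — *"hence by any positive power of g_k"*: `‖𝐇^{(k)}(b)‖ ≤ 2·K·ε_k·g_k^{2N}` with (2.5)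
  `R_k ≥ (log g_k⁻²)^r`, `r ≥ 1`, `0 < g_k < 1`, `N ≤ (log g_k⁻²)^{r−1}` (gen-4's `norm_bH_le_pow`).
* `norm_bH322_le_lattice_of_ineq190_gamma` — the bound with p29's four located `s`-conditions and the smallness `≤ ½` replaced by
  `0 ≤ ε_k ≤ 1`, `d ≥ 1` and explicit clauses in γ and the (52)-parameter `α₀` (`e^{−R_k} ≤ γ²` by (2.5), `0 < g_k ≤ γ`,
  `log γ⁻² ≥ 1`; `located319_of_gamma`; `2Kγ² ≤ 1`).
HONEST SCOPE.  (190) itself, (2.61), the B-size bound `44d²B₃ε_{k+1}` and the localisation distance of the argument field (*"with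
similar bounds"*, p. 269 — the (3.18) sentence transported to the determining set of (2.14); printed shapes), the mean-value
reading `hmv`, the dictionary `hdom`, and the clause `(1 + g²_{k+1}β′)^{β₀} ≤ δM₂` behind `R_k ≤ δLM₂R_{k+1}` are HYPOTHESES; the
lattice model is p29's ((M1)–(M4) of `B14Ineq319Proof`: `ℤ^d` carriers of [12]/[14], values in a complete normed `ℂ`-algebra
with `‖1‖ = 1`, not assumed commutative, `G ⊂ U1` averaging-closed, gauge fixing `glev`, (52)-type input); the ANALYTICITY clause
of p. 269 is gen-4's `B14.Eq322Analytic.analyticAt_bH` (its [15]-analyticity input untouched here).  Value = the p. 269 bound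
of row B14.Eq3.21–3.22 with no `𝐇`-hypothesis left, kernel-checked; NOT summit progress.
VERSIONS.  v1 = p264598 (commit df5315065122; the three theorems above, r11 gen 7).  v1.1 (this file, r11 gen 95) is
APPEND-ONLY: the new section *"(2.8)/(2.9) BY NAME"* at the end adds `norm_bH322_le_lattice_of_ineq190_gamma_byname` and
`norm_bH322_le_pow_lattice_of_ineq190_byname`, in which the one-step flow letter `hflow : ε_{k+1} ≤ (1+β₀)ε_k` and the radii
letter `hRR : R_k ≤ δLM₂R_{k+1}` of v1 are DERIVED from r11's typed (2.8) `B14.FlowIneq28` and (2.9) `B14FlowStep.FlowIneq29`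
(rows B14.Eq2.8 / B14.Eq2.9) at the step `k → k+1 ≤ K` through gen 94's `B14Ineq319From190.eps_succ_le_of_flowIneq28` and
gen 7's `R_le_of_flowIneq29` — p. 269 *"It yields the representation (3.18) … with similar bounds"* uses (2.8)/(2.9) exactly as
p. 268 does.  No v1 declaration, statement or proof is changed.
-/

open NormedSpace Finset

namespace Literature.MathematicalPhysics.QuantumFieldTheory.Balaban1983to89.B14Eq322From190

open Literature.MathematicalPhysics.QuantumFieldTheory.Balaban1983to89
open B7Prop1Explicit B7Prop2Explicit B7Prop3Flat B7Eq92Concrete B7Eq162General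
open B11SectG B15GammaSmallness B14Ineq319Proof B14Ineq319From190

variable {g : B6.Geometry} {FB : Type} [AddCommGroup FB] [Module ℝ FB]
variable {d : ℕ}
-- `𝔸` in `Type` (not `Type*`): `B11SectG.BlockNorm` takes its field space in `Type`.
variable {𝔸 : Type} [NormedRing 𝔸] [NormedAlgebra ℂ 𝔸] [CompleteSpace 𝔸] [NormOneClass 𝔸]

/-- **p. 269 after (3.22), THE BOUND, ON THE LATTICE MODEL, FROM [15] (190)**: *"bounded on the set S_{k+1} by
O(1)ε_k exp(−R_k)"* — `‖𝐇^{(k)}(b)‖ ≤ 2·(68(d+1)+160d)·44d²B₃²(1+β₀)·ε_k·e^{−R_k}` for `𝐇^{(k)}(b) = (1/i)log(V^{(k)}(b)V^{(k)}_{Λ^c∩Λ_k}(b)⁻¹)`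
with `V^{(k)}(b) = M^k((e^{iL^{−(k+1)}𝐇}U₀)^{u⁻¹})(b)`, `V^{(k)}_{Λ^c∩Λ_k}(b) = M^k(U₀)(b)` (print's (3.17)/(3.18) *"with U_{k+1,□′}
replaced by"* `U₀ = U_{k+1,Λ^c_{k+1}∩Λ_k}`): the (3.18)-type bound on `𝐇 = 𝐇_{k+1,Λ^c∩Λ_k}` DERIVED from (190) + (2.8)/(2.9)
(`boundH318_of_ineq190_second`) through the dictionary `hdom`, the [12]-mechanism `ineq319_first_local` (p29), and gen-4's
`norm_bH_le_O1` (`‖(1/i)log X‖ ≤ 2‖X − 1‖` for `‖X − 1‖ ≤ ½`, the smallness `hs`).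
[cite: Balaban1988Convergent, (3.22) p.269; Balaban1985Variational, (190) p.308] -/
theorem norm_bH322_le_lattice_of_ineq190
    -- [15]'s block-majorant data
    {T : Type*} {bB : BlockNorm g FB} {bout : BlockNorm g (B7Prop1Explicit.Site d → Fin d → 𝔸)}
    {dH : T → FB →ₗ[ℝ] (B7Prop1Explicit.Site d → Fin d → 𝔸)} {C δ₀ σ τ c D : ℝ}
    (h190 : ∀ t, Ineq190 bB bout (dH t) C δ₀) (hC : 0 ≤ C) (hd : ∀ a b : g.Site, 0 ≤ g.dist a b)
    (hrow : RowSum g σ c) (hτ : 0 ≤ τ) (hστ : σ + τ ≤ δ₀ / 8) (B : FB) (y : g.Site)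
    {B₃ δ M₂ R1 R β₀ ε εk1 : ℝ}
    (hm : ∀ y', bB.loc y' B ≤ 44 * (d : ℝ) ^ 2 * B₃ * εk1) (hD : ∀ y', bB.loc y' B ≠ 0 → D ≤ g.dist y y')
    {Hf : B7Prop1Explicit.Site d → Fin d → 𝔸}
    (hmv : ∀ s : ℝ, (∀ t, bout.loc y (dH t B) ≤ s) → bout.loc y Hf ≤ s)
    -- the lattice data (p29)
    {L : ℕ} (hL : 2 ≤ L) {G : Subgroup 𝔸ˣ} (hG : AvgClosed d L G) {k : ℕ}
    {U₀ : B7Prop1Explicit.Site d → Fin d → 𝔸ˣ} (hU₀ : ∀ x κ, U₀ x κ ∈ G) {α₀ : ℝ} (hα : 0 < α₀)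
    (hα3 : C0 d * α₀ ≤ 1 / 3) (hα4 : 4 * α₀ ≤ c2' d L) (h52 : pdev U₀ < α₀ * (((L : ℝ) ^ k)⁻¹) ^ 2)
    (q : B7Prop1Explicit.Site d) (κ : Fin d)
    (hgeom : δ * L * M₂ * R1 ≤ τ * D) (hCB : C * bB.κ * c ≤ B₃) (hB₃ : 0 ≤ B₃)
    -- (2.8), (2.9)
    (hε1 : 0 ≤ εk1) (hflow : εk1 ≤ (1 + β₀) * ε) (hRR : R ≤ δ * L * M₂ * R1)
    -- the dictionary
    (hdom : ∀ y' μ, B7Prop1Local.InBox (B7Prop1Local.loK L k q) (B7Prop1Local.bondHiK L k q κ) y' →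
      ‖Hf y' μ‖ ≤ bout.loc y Hf)
    -- p29's located inputs
    (hβ₀ : 0 ≤ 1 + β₀) (hε : 0 ≤ ε)
    (hsmall : Real.exp (4 * (800 * ((d : ℝ) + 1) ^ 2 * ((d : ℝ) + 4)) * α₀)
      * (1 + 8 * (131072 * ((d : ℝ) + 1) ^ 2) * (44 * (d : ℝ) ^ 2 * B₃ ^ 2 * (1 + β₀) * Real.exp (-R) * ε)) ≤ 2)
    (hc₃ : 2 * (44 * (d : ℝ) ^ 2 * B₃ ^ 2 * (1 + β₀) * Real.exp (-R) * ε) ≤ c3 d L)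
    (hsm : 2048 * (d : ℝ) * (44 * (d : ℝ) ^ 2 * B₃ ^ 2 * (1 + β₀) * Real.exp (-R) * ε) ≤ 1)
    (h1 : 128 * (44 * (d : ℝ) ^ 2 * B₃ ^ 2 * (1 + β₀) * Real.exp (-R) * ε) ≤ 1) (hL1 : 1 ≤ L)
    -- the domain of the log series (print: "is small")
    (hs : (68 * ((d : ℝ) + 1) + 160 * d) * 44 * (d : ℝ) ^ 2 * B₃ ^ 2 * (1 + β₀) * ε * Real.exp (-R) ≤ 1 / 2) :
    ‖B14.Eq316.bH (avgIter L
          (gaugeAct (B7Eq84Concrete.glev L hL1 U₀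
              (expCfg (fun z μ => ((Complex.I : ℂ) * ((((L : ℝ) ^ (k + 1))⁻¹ : ℝ) : ℂ)) • Hf z μ)) k 0)⁻¹
            (expCfg (fun z μ => ((Complex.I : ℂ) * ((((L : ℝ) ^ (k + 1))⁻¹ : ℝ) : ℂ)) • Hf z μ) * U₀)) k q κ)
        (avgIter L U₀ k q κ)‖
      ≤ 2 * ((68 * ((d : ℝ) + 1) + 160 * d) * 44 * (d : ℝ) ^ 2 * B₃ ^ 2 * (1 + β₀)) * ε * Real.exp (-R) := by
  have hloc := boundH318_of_ineq190_second h190 hC hd hrow hτ hστ B y hm hD hmv hgeom hCB hB₃ hε1 hflow hRR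
  have h318 : ∀ y' μ, B7Prop1Local.InBox (B7Prop1Local.loK L k q) (B7Prop1Local.bondHiK L k q κ) y' →
      ‖Hf y' μ‖ ≤ 44 * (d : ℝ) ^ 2 * B₃ ^ 2 * (1 + β₀) * Real.exp (-R) * ε :=
    fun y' μ hy => (hdom y' μ hy).trans hloc
  have h319 := ineq319_first_local hL hG hU₀ hα hα3 hα4 h52 Hf q κ hβ₀ hε h318 hsmall hc₃ hsm h1 hL1
  set V : 𝔸ˣ := avgIter L
          (gaugeAct (B7Eq84Concrete.glev L hL1 U₀
              (expCfg (fun z μ => ((Complex.I : ℂ) * ((((L : ℝ) ^ (k + 1))⁻¹ : ℝ) : ℂ)) • Hf z μ)) k 0)⁻¹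
            (expCfg (fun z μ => ((Complex.I : ℂ) * ((((L : ℝ) ^ (k + 1))⁻¹ : ℝ) : ℂ)) • Hf z μ) * U₀)) k q κ with hV
  set W : 𝔸ˣ := avgIter L U₀ k q κ with hW
  have hval : ((V * W⁻¹ : 𝔸ˣ) : 𝔸) = (V : 𝔸) * ((W⁻¹ : 𝔸ˣ) : 𝔸) := Units.val_mul _ _
  have h' : ‖((V * W⁻¹ : 𝔸ˣ) : 𝔸) - 1‖
      ≤ ((68 * ((d : ℝ) + 1) + 160 * d) * 44 * (d : ℝ) ^ 2 * B₃ ^ 2 * (1 + β₀)) * ε * Real.exp (-R) := by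
    rw [hval]
    exact h319.trans (le_of_eq (by ring))
  have hs' : ((68 * ((d : ℝ) + 1) + 160 * d) * 44 * (d : ℝ) ^ 2 * B₃ ^ 2 * (1 + β₀)) * ε * Real.exp (-R) ≤ 1 / 2 :=
    (le_of_eq (by ring)).trans hs
  exact B14.Eq322Analytic.norm_bH_le_O1 V W h' hs'

/-- **"hence by any positive power of g_k"** (p. 269), ON THE LATTICE MODEL, FROM [15] (190): as
`norm_bH322_le_lattice_of_ineq190`, then gen-4's `norm_bH_le_pow` with (2.5) `R_k ≥ (log g_k⁻²)^r` (`r ≥ 1`), `0 < g_k < 1`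
and `N ≤ (log g_k⁻²)^{r−1}`: `‖𝐇^{(k)}(b)‖ ≤ 2·K·ε_k·g_k^{2N}`, `K = (68(d+1)+160d)·44d²B₃²(1+β₀)`.
[cite: Balaban1988Convergent, (3.22) p.269, (2.5) p.255] -/
theorem norm_bH322_le_pow_lattice_of_ineq190
    {T : Type*} {bB : BlockNorm g FB} {bout : BlockNorm g (B7Prop1Explicit.Site d → Fin d → 𝔸)}
    {dH : T → FB →ₗ[ℝ] (B7Prop1Explicit.Site d → Fin d → 𝔸)} {C δ₀ σ τ c D : ℝ}
    (h190 : ∀ t, Ineq190 bB bout (dH t) C δ₀) (hC : 0 ≤ C) (hd : ∀ a b : g.Site, 0 ≤ g.dist a b)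
    (hrow : RowSum g σ c) (hτ : 0 ≤ τ) (hστ : σ + τ ≤ δ₀ / 8) (B : FB) (y : g.Site)
    {B₃ δ M₂ R1 R β₀ ε εk1 gk : ℝ} {r N : ℕ}
    (hm : ∀ y', bB.loc y' B ≤ 44 * (d : ℝ) ^ 2 * B₃ * εk1) (hD : ∀ y', bB.loc y' B ≠ 0 → D ≤ g.dist y y')
    {Hf : B7Prop1Explicit.Site d → Fin d → 𝔸}
    (hmv : ∀ s : ℝ, (∀ t, bout.loc y (dH t B) ≤ s) → bout.loc y Hf ≤ s)
    {L : ℕ} (hL : 2 ≤ L) {G : Subgroup 𝔸ˣ} (hG : AvgClosed d L G) {k : ℕ}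
    {U₀ : B7Prop1Explicit.Site d → Fin d → 𝔸ˣ} (hU₀ : ∀ x κ, U₀ x κ ∈ G) {α₀ : ℝ} (hα : 0 < α₀)
    (hα3 : C0 d * α₀ ≤ 1 / 3) (hα4 : 4 * α₀ ≤ c2' d L) (h52 : pdev U₀ < α₀ * (((L : ℝ) ^ k)⁻¹) ^ 2)
    (q : B7Prop1Explicit.Site d) (κ : Fin d)
    (hgeom : δ * L * M₂ * R1 ≤ τ * D) (hCB : C * bB.κ * c ≤ B₃) (hB₃ : 0 ≤ B₃)
    (hε1 : 0 ≤ εk1) (hflow : εk1 ≤ (1 + β₀) * ε) (hRR : R ≤ δ * L * M₂ * R1)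
    (hdom : ∀ y' μ, B7Prop1Local.InBox (B7Prop1Local.loK L k q) (B7Prop1Local.bondHiK L k q κ) y' →
      ‖Hf y' μ‖ ≤ bout.loc y Hf)
    (hβ₀ : 0 ≤ 1 + β₀) (hε : 0 ≤ ε)
    (hsmall : Real.exp (4 * (800 * ((d : ℝ) + 1) ^ 2 * ((d : ℝ) + 4)) * α₀)
      * (1 + 8 * (131072 * ((d : ℝ) + 1) ^ 2) * (44 * (d : ℝ) ^ 2 * B₃ ^ 2 * (1 + β₀) * Real.exp (-R) * ε)) ≤ 2)
    (hc₃ : 2 * (44 * (d : ℝ) ^ 2 * B₃ ^ 2 * (1 + β₀) * Real.exp (-R) * ε) ≤ c3 d L)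
    (hsm : 2048 * (d : ℝ) * (44 * (d : ℝ) ^ 2 * B₃ ^ 2 * (1 + β₀) * Real.exp (-R) * ε) ≤ 1)
    (h1 : 128 * (44 * (d : ℝ) ^ 2 * B₃ ^ 2 * (1 + β₀) * Real.exp (-R) * ε) ≤ 1) (hL1 : 1 ≤ L)
    (hs : (68 * ((d : ℝ) + 1) + 160 * d) * 44 * (d : ℝ) ^ 2 * B₃ ^ 2 * (1 + β₀) * ε * Real.exp (-R) ≤ 1 / 2)
    -- (2.5) and the power
    (hg : 0 < gk) (hg1 : gk < 1) (hr : 1 ≤ r) (hRg : (Real.log (gk ^ 2)⁻¹) ^ r ≤ R)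
    (hN : (N : ℝ) ≤ (Real.log (gk ^ 2)⁻¹) ^ (r - 1)) :
    ‖B14.Eq316.bH (avgIter L
          (gaugeAct (B7Eq84Concrete.glev L hL1 U₀
              (expCfg (fun z μ => ((Complex.I : ℂ) * ((((L : ℝ) ^ (k + 1))⁻¹ : ℝ) : ℂ)) • Hf z μ)) k 0)⁻¹
            (expCfg (fun z μ => ((Complex.I : ℂ) * ((((L : ℝ) ^ (k + 1))⁻¹ : ℝ) : ℂ)) • Hf z μ) * U₀)) k q κ)
        (avgIter L U₀ k q κ)‖
      ≤ 2 * ((68 * ((d : ℝ) + 1) + 160 * d) * 44 * (d : ℝ) ^ 2 * B₃ ^ 2 * (1 + β₀)) * ε * gk ^ (2 * N) := by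
  have hloc := boundH318_of_ineq190_second h190 hC hd hrow hτ hστ B y hm hD hmv hgeom hCB hB₃ hε1 hflow hRR
  have h318 : ∀ y' μ, B7Prop1Local.InBox (B7Prop1Local.loK L k q) (B7Prop1Local.bondHiK L k q κ) y' →
      ‖Hf y' μ‖ ≤ 44 * (d : ℝ) ^ 2 * B₃ ^ 2 * (1 + β₀) * Real.exp (-R) * ε :=
    fun y' μ hy => (hdom y' μ hy).trans hloc
  have h319 := ineq319_first_local hL hG hU₀ hα hα3 hα4 h52 Hf q κ hβ₀ hε h318 hsmall hc₃ hsm h1 hL1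
  set V : 𝔸ˣ := avgIter L
          (gaugeAct (B7Eq84Concrete.glev L hL1 U₀
              (expCfg (fun z μ => ((Complex.I : ℂ) * ((((L : ℝ) ^ (k + 1))⁻¹ : ℝ) : ℂ)) • Hf z μ)) k 0)⁻¹
            (expCfg (fun z μ => ((Complex.I : ℂ) * ((((L : ℝ) ^ (k + 1))⁻¹ : ℝ) : ℂ)) • Hf z μ) * U₀)) k q κ with hV
  set W : 𝔸ˣ := avgIter L U₀ k q κ with hW
  have hval : ((V * W⁻¹ : 𝔸ˣ) : 𝔸) = (V : 𝔸) * ((W⁻¹ : 𝔸ˣ) : 𝔸) := Units.val_mul _ _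
  have h' : ‖((V * W⁻¹ : 𝔸ˣ) : 𝔸) - 1‖
      ≤ ((68 * ((d : ℝ) + 1) + 160 * d) * 44 * (d : ℝ) ^ 2 * B₃ ^ 2 * (1 + β₀)) * ε * Real.exp (-R) := by
    rw [hval]
    exact h319.trans (le_of_eq (by ring))
  have hs' : ((68 * ((d : ℝ) + 1) + 160 * d) * 44 * (d : ℝ) ^ 2 * B₃ ^ 2 * (1 + β₀)) * ε * Real.exp (-R) ≤ 1 / 2 :=
    (le_of_eq (by ring)).trans hs
  have hK : 0 ≤ (68 * ((d : ℝ) + 1) + 160 * d) * 44 * (d : ℝ) ^ 2 * B₃ ^ 2 * (1 + β₀) := by positivity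
  exact B14.Eq322Analytic.norm_bH_le_pow V W hK hε h' hs' hg hg1 hr hRg hN

/-- **p. 269 after (3.22), THE BOUND, ON THE LATTICE MODEL, FROM [15] (190) AND γ**: as `norm_bH322_le_lattice_of_ineq190` with
`R = R_k` a natural number as in (2.5) (`B14.IsRj`, `r ≥ 1`), `0 < g_k ≤ γ`, `log γ⁻² ≥ 1`, and p29's four located `s`-conditions
and the smallness `≤ ½` replaced by `0 ≤ ε_k ≤ 1`, `d ≥ 1` and the explicit clauses of `B14Ineq319From190.located319_of_gamma`
plus `2·K·γ² ≤ 1` (`K = (68(d+1)+160d)·44d²B₃²(1+β₀)`; `K·ε_k·e^{−R_k} ≤ K·γ²`).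
[cite: Balaban1988Convergent, (3.22) p.269, (2.5) p.255] -/
theorem norm_bH322_le_lattice_of_ineq190_gamma
    {T : Type*} {bB : BlockNorm g FB} {bout : BlockNorm g (B7Prop1Explicit.Site d → Fin d → 𝔸)}
    {dH : T → FB →ₗ[ℝ] (B7Prop1Explicit.Site d → Fin d → 𝔸)} {C δ₀ σ τ c D : ℝ}
    (h190 : ∀ t, Ineq190 bB bout (dH t) C δ₀) (hC : 0 ≤ C) (hd : ∀ a b : g.Site, 0 ≤ g.dist a b)
    (hrow : RowSum g σ c) (hτ : 0 ≤ τ) (hστ : σ + τ ≤ δ₀ / 8) (B : FB) (y : g.Site)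
    {B₃ δ M₂ R1 β₀ ε εk1 γ gk : ℝ} {r R : ℕ}
    (hm : ∀ y', bB.loc y' B ≤ 44 * (d : ℝ) ^ 2 * B₃ * εk1) (hD : ∀ y', bB.loc y' B ≠ 0 → D ≤ g.dist y y')
    {Hf : B7Prop1Explicit.Site d → Fin d → 𝔸}
    (hmv : ∀ s : ℝ, (∀ t, bout.loc y (dH t B) ≤ s) → bout.loc y Hf ≤ s)
    {L : ℕ} (hL : 2 ≤ L) {G : Subgroup 𝔸ˣ} (hG : AvgClosed d L G) {k : ℕ}
    {U₀ : B7Prop1Explicit.Site d → Fin d → 𝔸ˣ} (hU₀ : ∀ x κ, U₀ x κ ∈ G) {α₀ : ℝ} (hα : 0 < α₀)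
    (hα3 : C0 d * α₀ ≤ 1 / 3) (hα4 : 4 * α₀ ≤ c2' d L) (h52 : pdev U₀ < α₀ * (((L : ℝ) ^ k)⁻¹) ^ 2)
    (q : B7Prop1Explicit.Site d) (κ : Fin d)
    (hgeom : δ * L * M₂ * R1 ≤ τ * D) (hCB : C * bB.κ * c ≤ B₃) (hB₃ : 0 ≤ B₃)
    (hεk1 : 0 ≤ εk1) (hflow : εk1 ≤ (1 + β₀) * ε) (hRR : (R : ℝ) ≤ δ * L * M₂ * R1)
    (hdom : ∀ y' μ, B7Prop1Local.InBox (B7Prop1Local.loK L k q) (B7Prop1Local.bondHiK L k q κ) y' →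
      ‖Hf y' μ‖ ≤ bout.loc y Hf)
    (hβ₀ : 0 ≤ 1 + β₀) (hε0 : 0 ≤ ε) (hε1 : ε ≤ 1) (hL1 : 1 ≤ L) (hd1 : 1 ≤ d)
    -- γ data
    (hr : 1 ≤ r) (hRj : B14.IsRj L r gk R) (hg : 0 < gk) (hgγ : gk ≤ γ) (hγe : 1 ≤ Real.log (γ ^ 2)⁻¹)
    (hsmγ : 2048 * (d : ℝ) * (44 * (d : ℝ) ^ 2 * B₃ ^ 2 * (1 + β₀) * γ ^ 2) ≤ 1)
    (hc₃γ : 2 * (44 * (d : ℝ) ^ 2 * B₃ ^ 2 * (1 + β₀) * γ ^ 2) ≤ c3 d L)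
    (hsmallγ : Real.exp (4 * (800 * ((d : ℝ) + 1) ^ 2 * ((d : ℝ) + 4)) * α₀)
      * (1 + 8 * (131072 * ((d : ℝ) + 1) ^ 2) * (44 * (d : ℝ) ^ 2 * B₃ ^ 2 * (1 + β₀) * γ ^ 2)) ≤ 2)
    (hsγ : 2 * ((68 * ((d : ℝ) + 1) + 160 * d) * 44 * (d : ℝ) ^ 2 * B₃ ^ 2 * (1 + β₀)) * γ ^ 2 ≤ 1) :
    ‖B14.Eq316.bH (avgIter L
          (gaugeAct (B7Eq84Concrete.glev L hL1 U₀
              (expCfg (fun z μ => ((Complex.I : ℂ) * ((((L : ℝ) ^ (k + 1))⁻¹ : ℝ) : ℂ)) • Hf z μ)) k 0)⁻¹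
            (expCfg (fun z μ => ((Complex.I : ℂ) * ((((L : ℝ) ^ (k + 1))⁻¹ : ℝ) : ℂ)) • Hf z μ) * U₀)) k q κ)
        (avgIter L U₀ k q κ)‖
      ≤ 2 * ((68 * ((d : ℝ) + 1) + 160 * d) * 44 * (d : ℝ) ^ 2 * B₃ ^ 2 * (1 + β₀)) * ε * Real.exp (-(R : ℝ)) := by
  obtain ⟨hsmall, hc₃, hsm, h1⟩ := located319_of_gamma (B₃ := B₃) (α₀ := α₀) hd1 hr hRj hg hgγ hγe hβ₀ hε0 hε1 hsmγ hc₃γ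
    hsmallγ
  -- the smallness `K ε e^{−R} ≤ ½` from `e^{−R} ≤ γ²`, `ε ≤ 1` and `2Kγ² ≤ 1`
  have he : Real.exp (-(R : ℝ)) ≤ γ ^ 2 := exp_neg_R_le_gamma_sq hr hRj hg hgγ hγe
  have hK : 0 ≤ (68 * ((d : ℝ) + 1) + 160 * d) * 44 * (d : ℝ) ^ 2 * B₃ ^ 2 * (1 + β₀) := by positivity
  have h2 : ε * Real.exp (-(R : ℝ)) ≤ 1 * γ ^ 2 := mul_le_mul hε1 he (Real.exp_nonneg _) zero_le_one
  have hs : (68 * ((d : ℝ) + 1) + 160 * d) * 44 * (d : ℝ) ^ 2 * B₃ ^ 2 * (1 + β₀) * ε * Real.exp (-(R : ℝ)) ≤ 1 / 2 := by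
    have h3 := mul_le_mul_of_nonneg_left h2 hK
    have e1 : (68 * ((d : ℝ) + 1) + 160 * d) * 44 * (d : ℝ) ^ 2 * B₃ ^ 2 * (1 + β₀) * ε * Real.exp (-(R : ℝ))
        = (68 * ((d : ℝ) + 1) + 160 * d) * 44 * (d : ℝ) ^ 2 * B₃ ^ 2 * (1 + β₀) * (ε * Real.exp (-(R : ℝ))) := by ring
    rw [e1]
    linarith
  exact norm_bH322_le_lattice_of_ineq190 h190 hC hd hrow hτ hστ B y hm hD hmv hL hG hU₀ hα hα3 hα4 h52 q κ hgeom hCB hB₃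
    hεk1 hflow hRR hdom hβ₀ hε0 hsmall hc₃ hsm h1 hL1 hs

/-! ## (v1.1) [III] (2.8)/(2.9) BY NAME — the flow letters of the p. 269 bound from r11's typed rows B14.Eq2.8 / B14.Eq2.9

p. 269: *"We use again the formula (3.17), but with U_{k+1,□′} replaced by the above function. It yields the representation
(3.18) with the corresponding changes, … and with similar bounds"* — i.e. the second inequality of (3.18) p. 268,
*"B₃exp(−δLM₂R_{k+1})44d²B₃ε_{k+1} ≦ 44d²B₃²(1+β₀)exp(−R_k)ε_k"*, which uses (2.8) *"ε_n ≦ (1+β₀)(n−m)^{1/2}ε_m"* and (2.9)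
*"R_m ≦ L(1+g_n²β′(n−m))^{β₀}R_n"* (p. 256) at ONE step `(m, n) = (k, k+1)`.  v1 carries that step as the letters `hflow` /
`hRR`; here they are taken BY NAME from `B14.FlowIneq28 ε g β′ β₀ K` / `B14FlowStep.FlowIneq29 R g L β′ β₀ K` through
`B14Ineq319From190.eps_succ_le_of_flowIneq28` (r11 gen 94, v1.2 p356332) and `B14Ineq319From190.R_le_of_flowIneq29` (gen 7)
with the clause `(1 + g²_{k+1}β′)^{β₀} ≤ δM₂` (*"M₂ sufficiently large"*), exactly as §3 of `B14Ineq319From190` does for (3.19).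
Theorems only; nothing restated; v1 untouched. -/

/-- **p. 269 after (3.22), THE BOUND, ON THE LATTICE MODEL, FROM [15] (190) AND γ, WITH (2.5), (2.8), (2.9) BY NAME**:
`norm_bH322_le_lattice_of_ineq190_gamma` with its flow letter `hflow : ε_{k+1} ≤ (1+β₀)ε_k` and radii letter
`hRR : R_k ≤ δLM₂R_{k+1}` DERIVED from r11's typed (2.8) `B14.FlowIneq28 ε g β′ β₀ K` (`eps_succ_le_of_flowIneq28`) and (2.9)
`B14FlowStep.FlowIneq29 R g L β′ β₀ K` (`R_le_of_flowIneq29`) at the step `k → k+1 ≤ K` with the clause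
`(1 + g²_{k+1}β′)^{β₀} ≤ δM₂`; (2.5) by name as before (`hRj : B14.IsRj L r g_k R_k`); the sequences `ε`, `g`, `R` are those of
the inductive description ((2.4)–(2.9)), read at `k` and `k+1`.  Every other hypothesis verbatim.
[cite: Balaban1988Convergent, (3.22) p.269, (3.18) p.268, (2.5) p.255, (2.8)–(2.9) p.256; Balaban1985Variational, (190) p.308] -/
theorem norm_bH322_le_lattice_of_ineq190_gamma_byname
    {T : Type*} {bB : BlockNorm g FB} {bout : BlockNorm g (B7Prop1Explicit.Site d → Fin d → 𝔸)}
    {dH : T → FB →ₗ[ℝ] (B7Prop1Explicit.Site d → Fin d → 𝔸)} {C δ₀ σ τ c D : ℝ}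
    (h190 : ∀ t, Ineq190 bB bout (dH t) C δ₀) (hC : 0 ≤ C) (hd : ∀ a b : g.Site, 0 ≤ g.dist a b)
    (hrow : RowSum g σ c) (hτ : 0 ≤ τ) (hστ : σ + τ ≤ δ₀ / 8) (B : FB) (y : g.Site)
    {B₃ δ M₂ β' β₀ γ : ℝ} {ε gseq : ℕ → ℝ} {Rseq : ℕ → ℕ} {r K k : ℕ}
    (hm : ∀ y', bB.loc y' B ≤ 44 * (d : ℝ) ^ 2 * B₃ * ε (k + 1)) (hD : ∀ y', bB.loc y' B ≠ 0 → D ≤ g.dist y y')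
    {Hf : B7Prop1Explicit.Site d → Fin d → 𝔸}
    (hmv : ∀ s : ℝ, (∀ t, bout.loc y (dH t B) ≤ s) → bout.loc y Hf ≤ s)
    {L : ℕ} (hL : 2 ≤ L) {G : Subgroup 𝔸ˣ} (hG : AvgClosed d L G)
    {U₀ : B7Prop1Explicit.Site d → Fin d → 𝔸ˣ} (hU₀ : ∀ x κ, U₀ x κ ∈ G) {α₀ : ℝ} (hα : 0 < α₀)
    (hα3 : C0 d * α₀ ≤ 1 / 3) (hα4 : 4 * α₀ ≤ c2' d L) (h52 : pdev U₀ < α₀ * (((L : ℝ) ^ k)⁻¹) ^ 2)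
    (q : B7Prop1Explicit.Site d) (κ : Fin d)
    (hgeom : δ * L * M₂ * Rseq (k + 1) ≤ τ * D) (hCB : C * bB.κ * c ≤ B₃) (hB₃ : 0 ≤ B₃)
    (hεk1 : 0 ≤ ε (k + 1))
    -- (2.8), (2.9) BY NAME at the step k → k+1 ≤ K, and "M₂ sufficiently large"
    (h28 : B14.FlowIneq28 ε gseq β' β₀ K) (h29 : B14FlowStep.FlowIneq29 Rseq gseq L β' β₀ K) (hk : k + 1 ≤ K)
    (hM₂ : (1 + gseq (k + 1) ^ 2 * β') ^ β₀ ≤ δ * M₂)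
    -- the dictionary
    (hdom : ∀ y' μ, B7Prop1Local.InBox (B7Prop1Local.loK L k q) (B7Prop1Local.bondHiK L k q κ) y' →
      ‖Hf y' μ‖ ≤ bout.loc y Hf)
    (hβ₀ : 0 ≤ 1 + β₀) (hε0 : 0 ≤ ε k) (hε1 : ε k ≤ 1) (hL1 : 1 ≤ L) (hd1 : 1 ≤ d)
    -- (2.5) BY NAME and the γ data
    (hr : 1 ≤ r) (hRj : B14.IsRj L r (gseq k) (Rseq k)) (hg : 0 < gseq k) (hgγ : gseq k ≤ γ)
    (hγe : 1 ≤ Real.log (γ ^ 2)⁻¹)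
    (hsmγ : 2048 * (d : ℝ) * (44 * (d : ℝ) ^ 2 * B₃ ^ 2 * (1 + β₀) * γ ^ 2) ≤ 1)
    (hc₃γ : 2 * (44 * (d : ℝ) ^ 2 * B₃ ^ 2 * (1 + β₀) * γ ^ 2) ≤ c3 d L)
    (hsmallγ : Real.exp (4 * (800 * ((d : ℝ) + 1) ^ 2 * ((d : ℝ) + 4)) * α₀)
      * (1 + 8 * (131072 * ((d : ℝ) + 1) ^ 2) * (44 * (d : ℝ) ^ 2 * B₃ ^ 2 * (1 + β₀) * γ ^ 2)) ≤ 2)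
    (hsγ : 2 * ((68 * ((d : ℝ) + 1) + 160 * d) * 44 * (d : ℝ) ^ 2 * B₃ ^ 2 * (1 + β₀)) * γ ^ 2 ≤ 1) :
    ‖B14.Eq316.bH (avgIter L
          (gaugeAct (B7Eq84Concrete.glev L hL1 U₀
              (expCfg (fun z μ => ((Complex.I : ℂ) * ((((L : ℝ) ^ (k + 1))⁻¹ : ℝ) : ℂ)) • Hf z μ)) k 0)⁻¹
            (expCfg (fun z μ => ((Complex.I : ℂ) * ((((L : ℝ) ^ (k + 1))⁻¹ : ℝ) : ℂ)) • Hf z μ) * U₀)) k q κ)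
        (avgIter L U₀ k q κ)‖
      ≤ 2 * ((68 * ((d : ℝ) + 1) + 160 * d) * 44 * (d : ℝ) ^ 2 * B₃ ^ 2 * (1 + β₀)) * ε k * Real.exp (-(Rseq k : ℝ)) :=
  norm_bH322_le_lattice_of_ineq190_gamma h190 hC hd hrow hτ hστ B y hm hD hmv hL hG hU₀ hα hα3 hα4 h52 q κ hgeom hCB hB₃
    hεk1 (eps_succ_le_of_flowIneq28 h28 hk) (R_le_of_flowIneq29 h29 hk hM₂) hdom hβ₀ hε0 hε1 hL1 hd1 hr hRj hg hgγ hγe hsmγ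
    hc₃γ hsmallγ hsγ

/-- **"hence by any positive power of g_k"** (p. 269), ON THE LATTICE MODEL, FROM [15] (190), WITH (2.5), (2.8), (2.9) BY
NAME: `norm_bH322_le_pow_lattice_of_ineq190` with `hflow`/`hRR` DERIVED from `B14.FlowIneq28` / `B14FlowStep.FlowIneq29` at the
step `k → k+1 ≤ K` (clause `(1 + g²_{k+1}β′)^{β₀} ≤ δM₂`) and the lower half of (2.5) READ OFF r11's typed `B14.IsRj L r g_k R_k`
(its second conjunct `(log g_k⁻²)^r ≤ R_k`): `‖𝐇^{(k)}(b)‖ ≤ 2·K₀·ε_k·g_k^{2N}` for `N ≤ (log g_k⁻²)^{r−1}`.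
[cite: Balaban1988Convergent, (3.22) p.269, (2.5) p.255, (2.8)–(2.9) p.256] -/
theorem norm_bH322_le_pow_lattice_of_ineq190_byname
    {T : Type*} {bB : BlockNorm g FB} {bout : BlockNorm g (B7Prop1Explicit.Site d → Fin d → 𝔸)}
    {dH : T → FB →ₗ[ℝ] (B7Prop1Explicit.Site d → Fin d → 𝔸)} {C δ₀ σ τ c D : ℝ}
    (h190 : ∀ t, Ineq190 bB bout (dH t) C δ₀) (hC : 0 ≤ C) (hd : ∀ a b : g.Site, 0 ≤ g.dist a b)
    (hrow : RowSum g σ c) (hτ : 0 ≤ τ) (hστ : σ + τ ≤ δ₀ / 8) (B : FB) (y : g.Site)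
    {B₃ δ M₂ β' β₀ : ℝ} {ε gseq : ℕ → ℝ} {Rseq : ℕ → ℕ} {r N K k : ℕ}
    (hm : ∀ y', bB.loc y' B ≤ 44 * (d : ℝ) ^ 2 * B₃ * ε (k + 1)) (hD : ∀ y', bB.loc y' B ≠ 0 → D ≤ g.dist y y')
    {Hf : B7Prop1Explicit.Site d → Fin d → 𝔸}
    (hmv : ∀ s : ℝ, (∀ t, bout.loc y (dH t B) ≤ s) → bout.loc y Hf ≤ s)
    {L : ℕ} (hL : 2 ≤ L) {G : Subgroup 𝔸ˣ} (hG : AvgClosed d L G)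
    {U₀ : B7Prop1Explicit.Site d → Fin d → 𝔸ˣ} (hU₀ : ∀ x κ, U₀ x κ ∈ G) {α₀ : ℝ} (hα : 0 < α₀)
    (hα3 : C0 d * α₀ ≤ 1 / 3) (hα4 : 4 * α₀ ≤ c2' d L) (h52 : pdev U₀ < α₀ * (((L : ℝ) ^ k)⁻¹) ^ 2)
    (q : B7Prop1Explicit.Site d) (κ : Fin d)
    (hgeom : δ * L * M₂ * Rseq (k + 1) ≤ τ * D) (hCB : C * bB.κ * c ≤ B₃) (hB₃ : 0 ≤ B₃)
    (hε1 : 0 ≤ ε (k + 1))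
    -- (2.8), (2.9) BY NAME at the step k → k+1 ≤ K, and "M₂ sufficiently large"
    (h28 : B14.FlowIneq28 ε gseq β' β₀ K) (h29 : B14FlowStep.FlowIneq29 Rseq gseq L β' β₀ K) (hk : k + 1 ≤ K)
    (hM₂ : (1 + gseq (k + 1) ^ 2 * β') ^ β₀ ≤ δ * M₂)
    (hdom : ∀ y' μ, B7Prop1Local.InBox (B7Prop1Local.loK L k q) (B7Prop1Local.bondHiK L k q κ) y' →
      ‖Hf y' μ‖ ≤ bout.loc y Hf)
    (hβ₀ : 0 ≤ 1 + β₀) (hε : 0 ≤ ε k)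
    (hsmall : Real.exp (4 * (800 * ((d : ℝ) + 1) ^ 2 * ((d : ℝ) + 4)) * α₀)
      * (1 + 8 * (131072 * ((d : ℝ) + 1) ^ 2) *
        (44 * (d : ℝ) ^ 2 * B₃ ^ 2 * (1 + β₀) * Real.exp (-(Rseq k : ℝ)) * ε k)) ≤ 2)
    (hc₃ : 2 * (44 * (d : ℝ) ^ 2 * B₃ ^ 2 * (1 + β₀) * Real.exp (-(Rseq k : ℝ)) * ε k) ≤ c3 d L)
    (hsm : 2048 * (d : ℝ) * (44 * (d : ℝ) ^ 2 * B₃ ^ 2 * (1 + β₀) * Real.exp (-(Rseq k : ℝ)) * ε k) ≤ 1)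
    (h1 : 128 * (44 * (d : ℝ) ^ 2 * B₃ ^ 2 * (1 + β₀) * Real.exp (-(Rseq k : ℝ)) * ε k) ≤ 1) (hL1 : 1 ≤ L)
    (hs : (68 * ((d : ℝ) + 1) + 160 * d) * 44 * (d : ℝ) ^ 2 * B₃ ^ 2 * (1 + β₀) * ε k * Real.exp (-(Rseq k : ℝ)) ≤ 1 / 2)
    -- (2.5) BY NAME and the power
    (hRj : B14.IsRj L r (gseq k) (Rseq k)) (hg : 0 < gseq k) (hg1 : gseq k < 1) (hr : 1 ≤ r)
    (hN : (N : ℝ) ≤ (Real.log (gseq k ^ 2)⁻¹) ^ (r - 1)) :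
    ‖B14.Eq316.bH (avgIter L
          (gaugeAct (B7Eq84Concrete.glev L hL1 U₀
              (expCfg (fun z μ => ((Complex.I : ℂ) * ((((L : ℝ) ^ (k + 1))⁻¹ : ℝ) : ℂ)) • Hf z μ)) k 0)⁻¹
            (expCfg (fun z μ => ((Complex.I : ℂ) * ((((L : ℝ) ^ (k + 1))⁻¹ : ℝ) : ℂ)) • Hf z μ) * U₀)) k q κ)
        (avgIter L U₀ k q κ)‖
      ≤ 2 * ((68 * ((d : ℝ) + 1) + 160 * d) * 44 * (d : ℝ) ^ 2 * B₃ ^ 2 * (1 + β₀)) * ε k * gseq k ^ (2 * N) := by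
  obtain ⟨s, hs', hRlog, -⟩ := hRj
  exact norm_bH322_le_pow_lattice_of_ineq190 h190 hC hd hrow hτ hστ B y hm hD hmv hL hG hU₀ hα hα3 hα4 h52 q κ hgeom hCB hB₃
    hε1 (eps_succ_le_of_flowIneq28 h28 hk) (R_le_of_flowIneq29 h29 hk hM₂) hdom hβ₀ hε hsmall hc₃ hsm h1 hL1 hs hg hg1 hr
    hRlog hN

end Literature.MathematicalPhysics.QuantumFieldTheory.Balaban1983to89.B14Eq322From190
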